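import Summits.SmoothPoincare4.SmoothPoincare4.Theorems.SullivanDualTargetOfSympcap
import Literature.Geometry.Symplectic.GromovR4StdModel
import Mathlib.Analysis.Calculus.FDeriv.Norm
import Mathlib.Analysis.InnerProductSpace.Calculus
import Mathlib.Analysis.SpecialFunctions.Sqrt

/-!
# SmoothPoincare4 / SullivanDual — crux `Target` (stmt-SmoothPoincare4-7823), line `kaehler-jacket`:
# helper `helper_collarInterpolation` (sub-goal D2 of `stub_ballExtension`)

Let `κ : ℝ⁴ → ℝ⁴` be a collar map near the unit sphere: a smooth immersion on the shell
`|‖y‖ - 1| < δ₁`, with first-order data along the sphere packaged as in the sibling helper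
`helper_collarFirstOrder` (a lower bound `m ≤ ⟪dκ(θ)θ, θ⟫`, a bound `‖dκ(θ)‖ ≤ W`, the tangential
identity `dκ(θ)v = v` for `v ⊥ θ`, and uniform first-order Taylor control in the radial
variable), and let a log-slow monotone smooth step `χ` be available at every scale (sibling helper
`helper_slowStep`).  We prove that `κ` can be interpolated to an immersion of the open ball
`‖y‖ < 1 + δ₁` which is `κ` on an outer collar `1 - δ₂ < ‖y‖` and the identity on
`‖y‖ ≤ 1 - δ₁`.

Construction: `κ' y = y + a(‖y‖) • (κ y - y)` with the cut-off `a r = 1 - χ (1 - r)`, where `χ`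
is the slow step at scale `t₁ = δ/2` and slowness `η`; `a = 1` for `r ≥ 1 - t₀`, `a = 0` for
`r ≤ 1 - δ/2`, `0 ≤ a ≤ 1` and `0 ≤ (1 - r) a'(r) ≤ η`.  On the transition zone the differential
is `dκ'(y)v = v + (b ⟪θ, v⟫) • w_θ + error` with `θ = y/‖y‖`, `w_θ = dκ(θ)θ - θ`,
`b = a - (1 - r)a' ∈ [-η, 1]` and `‖error‖ ≤ ε(1 + η)‖v‖`; the rank-one main term is bounded
below by the Sherman–Morrison estimate `‖v + (b⟪θ,v⟫) • w‖ ≥ ‖v‖ / (1 + |b|‖w‖/m')` whenever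
`1 + b⟪θ, w⟫ ≥ m' > 0`, and `ε` is chosen so small that the error cannot cancel it.  All of this
is elementary multivariable calculus. [folklore]
-/

noncomputable section

set_option linter.dupNamespace false

open scoped Manifold ContDiff Topology
open Set Function
open Literature.Geometry.Kaehler (MForm IsSmoothForm IsClosedForm mextDeriv)
open Literature.Geometry.Symplectic (punctured InPuncturedChartBall stdSymplecticForm inversion
  invertedStdForm IsSymplecticStandardNearPoint AgreesWithInvertedChartNear)
open Literature.Topology.FourManifolds (HomotopySphere)

namespace Summit.SmoothPoincare4.SmoothPoincare4.Theorems.Target.KaehlerJacket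

local notation "E4" => EuclideanSpace ℝ (Fin 4)

/-- **Sherman–Morrison lower bound.** For a unit vector `θ` and a rank-one perturbation of the
identity `v ↦ v + (b ⟪θ, v⟫) • w` whose "determinant" `1 + b ⟪θ, w⟫` is at least `mm > 0`, one has
`‖v‖ ≤ (1 + |b| ‖w‖ / mm) ‖v + (b ⟪θ, v⟫) • w‖`. [folklore] -/
theorem collarInterp_shermanMorrison (θ w v : E4) (b mm : ℝ) (hθ : ‖θ‖ = 1) (hmm : 0 < mm)
    (hle : mm ≤ 1 + b * inner ℝ θ w) :
    ‖v‖ ≤ (1 + |b| * ‖w‖ / mm) * ‖v + (b * inner ℝ θ v) • w‖ := by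
  set z := v + (b * inner ℝ θ v) • w with hz
  have hpos : 0 < 1 + b * inner ℝ θ w := hmm.trans_le hle
  have hθz : inner ℝ θ z = inner ℝ θ v * (1 + b * inner ℝ θ w) := by
    rw [hz, inner_add_right, real_inner_smul_right]; ring
  have hθv : inner ℝ θ v = inner ℝ θ z / (1 + b * inner ℝ θ w) := by
    rw [hθz, mul_div_cancel_right₀ _ hpos.ne']
  have hv : v = z - (b * inner ℝ θ v) • w := by rw [hz, add_sub_cancel_right]
  have hzb : |inner ℝ θ z| ≤ ‖z‖ := by
    calc |inner ℝ θ z| ≤ ‖θ‖ * ‖z‖ := abs_real_inner_le_norm θ z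
      _ = ‖z‖ := by rw [hθ, one_mul]
  calc ‖v‖ = ‖z - (b * inner ℝ θ v) • w‖ := by rw [← hv]
    _ ≤ ‖z‖ + ‖(b * inner ℝ θ v) • w‖ := norm_sub_le _ _
    _ = ‖z‖ + |b| * (|inner ℝ θ z| / (1 + b * inner ℝ θ w)) * ‖w‖ := by
        rw [norm_smul, Real.norm_eq_abs, abs_mul, hθv, abs_div, abs_of_pos hpos]
    _ ≤ ‖z‖ + |b| * (‖z‖ / mm) * ‖w‖ := by gcongr
    _ = (1 + |b| * ‖w‖ / mm) * ‖z‖ := by ring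

/-- **Rank-one form of a differential fixing the tangent directions.** If a linear map `K` of
`ℝ⁴` fixes every vector orthogonal to the unit vector `θ`, then `K v = v + ⟪θ, v⟫ • (K θ - θ)`
for every `v`. [folklore] -/
theorem collarInterp_apply_eq_of_tangential (θ : E4) (hθ : ‖θ‖ = 1) (K : E4 →L[ℝ] E4)
    (hK : ∀ v : E4, inner ℝ v θ = 0 → K v = v) (v : E4) :
    K v = v + inner ℝ θ v • (K θ - θ) := by
  have hθθ : inner ℝ θ θ = 1 := by rw [real_inner_self_eq_norm_sq, hθ, one_pow]
  set c := inner ℝ θ v with hc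
  have ht : inner ℝ (v - c • θ) θ = 0 := by
    rw [inner_sub_left, real_inner_smul_left, hθθ, mul_one, hc, real_inner_comm, sub_self]
  calc K v = K ((v - c • θ) + c • θ) := by rw [sub_add_cancel]
    _ = (v - c • θ) + c • K θ := by rw [map_add, map_smul, hK _ ht]
    _ = v + c • (K θ - θ) := by rw [smul_sub]; abel

/-- **Positivity of the Sherman–Morrison determinant on the transition zone.** With
`p = a ∈ [0, 1]`, `q = (1 - r) a' ∈ [0, η]`, `G = ⟪dκ(θ)θ, θ⟫ ∈ [m₁, W]` and `η (W + 1) ≤ m₁ / 4`,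
the determinant `1 + (p - q)(G - 1)` is at least `m₁ / 2`. [folklore] -/
theorem collarInterp_det_lower_bound {p q G m₁ W η : ℝ} (hp0 : 0 ≤ p) (hp1 : p ≤ 1) (hq0 : 0 ≤ q)
    (hqη : q ≤ η) (hG₁ : m₁ ≤ G) (hG₂ : G ≤ W) (hm₁0 : 0 < m₁) (hm₁1 : m₁ ≤ 1) (hW : 0 ≤ W)
    (hηW : η * (W + 1) ≤ m₁ / 4) : m₁ / 2 ≤ 1 + (p - q) * (G - 1) := by
  nlinarith [mul_nonneg hp0 (sub_nonneg.2 hG₁), mul_nonneg (sub_nonneg.2 hp1) (sub_nonneg.2 hm₁1),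
    mul_nonneg hq0 (sub_nonneg.2 hG₂), mul_nonneg (sub_nonneg.2 hqη) hW, hq0.trans hqη]

/-- **Kernel triviality on the transition zone.** The linear-algebra heart of the interpolation:
if `θ` is a unit vector, `K₀ u = u + ⟪θ, u⟫ • w` with `m₁ ≤ 1 + ⟪θ, w⟫ ≤ W`, `‖w‖ ≤ W + 1`,
`‖K - K₀‖ ≤ ε`, `‖d - (r - 1) • w‖ ≤ ε |r - 1|`, `p ∈ [0, 1]`, `(1 - r) a' ∈ [0, η]`, and the
constants satisfy `η (W + 1) ≤ m₁ / 4`, `ε (1 + η) (1 + 4 (W + 1) / m₁) ≤ 1 / 2`, then the map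
`v ↦ v + p • (K v - v) + (a' ⟪θ, v⟫) • d` has trivial kernel: its rank-one main part
`v + (b ⟪θ, v⟫) • w`, `b = p - (1 - r) a'`, dominates (Sherman–Morrison) the error, which is
at most `ε (1 + η) ‖v‖`. [folklore] -/
theorem collarInterp_eq_zero_of_fderiv_eq_zero {θ w d v : E4} {K K₀ : E4 →L[ℝ] E4}
    {p a' r ε η m₁ W : ℝ} (hθ : ‖θ‖ = 1)
    (hK₀v : ∀ u : E4, K₀ u = u + inner ℝ θ u • w)
    (hG₁ : m₁ ≤ 1 + inner ℝ θ w) (hG₂ : 1 + inner ℝ θ w ≤ W) (hw : ‖w‖ ≤ W + 1)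
    (hK : ‖K - K₀‖ ≤ ε) (hd : ‖d - (r - 1) • w‖ ≤ ε * |r - 1|)
    (hp0 : 0 ≤ p) (hp1 : p ≤ 1) (hq0 : 0 ≤ (1 - r) * a') (hqη : (1 - r) * a' ≤ η)
    (hm₁0 : 0 < m₁) (hm₁1 : m₁ ≤ 1) (hW : 0 ≤ W) (hηW : η * (W + 1) ≤ m₁ / 4) (hε0 : 0 ≤ ε)
    (hεB : ε * (1 + η) * (1 + 4 * (W + 1) / m₁) ≤ 1 / 2)
    (hv : v + p • (K v - v) + (a' * inner ℝ θ v) • d = 0) : v = 0 := by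
  set c := inner ℝ θ v with hc
  set q := (1 - r) * a' with hq
  set E₂ := d - (r - 1) • w with hE₂
  set main := v + ((p - q) * c) • w with hmain
  set err := p • (K - K₀) v + (a' * c) • E₂ with herr
  have hη0 : 0 ≤ η := hq0.trans hqη
  have hη1 : η ≤ 1 := by
    have : η ≤ η * (W + 1) := le_mul_of_one_le_right hη0 (by linarith)
    linarith
  -- the splitting `dκ' v = main + err`
  have hsplit : v + p • (K v - v) + (a' * c) • d = main + err := by
    have hKv : K v = v + c • w + (K - K₀) v := by
      rw [sub_apply, hK₀v v]; abel
    have hd' : d = (r - 1) • w + E₂ := by rw [hE₂, add_sub_cancel]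
    rw [hKv, hd', hmain, herr, hq]
    module
  have hmain_eq : main = -err := eq_neg_of_add_eq_zero_left (hsplit ▸ hv)
  -- the error bound
  have hc_le : |c| ≤ ‖v‖ := by
    calc |c| ≤ ‖θ‖ * ‖v‖ := abs_real_inner_le_norm θ v
      _ = ‖v‖ := by rw [hθ, one_mul]
  have hE₁ : ‖(K - K₀) v‖ ≤ ε * ‖v‖ :=
    (ContinuousLinearMap.le_opNorm _ _).trans (mul_le_mul_of_nonneg_right hK (norm_nonneg v))
  have hqabs : |(1 - r) * a'| ≤ η := by rwa [abs_of_nonneg hq0]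
  have herr_le : ‖err‖ ≤ ε * (1 + η) * ‖v‖ := by
    calc ‖err‖ ≤ ‖p • (K - K₀) v‖ + ‖(a' * c) • E₂‖ := norm_add_le _ _
      _ = p * ‖(K - K₀) v‖ + |a'| * |c| * ‖E₂‖ := by
          rw [norm_smul, norm_smul, Real.norm_eq_abs, Real.norm_eq_abs, abs_of_nonneg hp0,
            abs_mul]
      _ ≤ p * (ε * ‖v‖) + |a'| * ‖v‖ * (ε * |r - 1|) := by gcongr
      _ = ε * ‖v‖ * (p + |(1 - r) * a'|) := by
          rw [abs_mul, abs_sub_comm 1 r]; ring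
      _ ≤ ε * ‖v‖ * (1 + η) := by gcongr
      _ = ε * (1 + η) * ‖v‖ := by ring
  -- the Sherman–Morrison lower bound for the main term
  have hdet : m₁ / 2 ≤ 1 + (p - q) * inner ℝ θ w := by
    have h :=
      collarInterp_det_lower_bound (G := 1 + inner ℝ θ w) hp0 hp1 hq0 hqη hG₁ hG₂ hm₁0 hm₁1 hW hηW
    simpa only [add_sub_cancel_left] using h
  have hSM := collarInterp_shermanMorrison θ w v (p - q) (m₁ / 2) hθ (by positivity) hdet
  have hb_abs : |p - q| ≤ 2 := abs_le.2 ⟨by linarith, by linarith⟩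
  have hB0 : 0 ≤ 1 + 4 * (W + 1) / m₁ := add_nonneg zero_le_one (div_nonneg (by linarith) hm₁0.le)
  have hfac : |p - q| * ‖w‖ / (m₁ / 2) ≤ 4 * (W + 1) / m₁ := by
    rw [div_le_div_iff₀ (by positivity) hm₁0]
    nlinarith [mul_le_mul hb_abs hw (norm_nonneg w) zero_le_two]
  have hv_le : ‖v‖ ≤ ‖v‖ / 2 := by
    calc ‖v‖ ≤ (1 + |p - q| * ‖w‖ / (m₁ / 2)) * ‖main‖ := hSM
      _ ≤ (1 + 4 * (W + 1) / m₁) * ‖main‖ := by gcongr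
      _ = (1 + 4 * (W + 1) / m₁) * ‖err‖ := by rw [hmain_eq, norm_neg]
      _ ≤ (1 + 4 * (W + 1) / m₁) * (ε * (1 + η) * ‖v‖) := mul_le_mul_of_nonneg_left herr_le hB0
      _ = ε * (1 + η) * (1 + 4 * (W + 1) / m₁) * ‖v‖ := by ring
      _ ≤ 1 / 2 * ‖v‖ := mul_le_mul_of_nonneg_right hεB (norm_nonneg v)
      _ = ‖v‖ / 2 := by ring
  exact norm_le_zero_iff.mp (by linarith [norm_nonneg v])

/-- **Derivative of the Euclidean norm** at a non-zero point: `d‖·‖(y) = ‖y‖⁻¹ ⟪y, ·⟫`.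
[folklore] -/
theorem collarInterp_hasFDerivAt_norm {y : E4} (hy : y ≠ 0) :
    HasFDerivAt (fun z : E4 => ‖z‖) (‖y‖⁻¹ • innerSL ℝ y) y := by
  have hy2 : ‖y‖ ^ 2 ≠ 0 := pow_ne_zero 2 (norm_ne_zero_iff.mpr hy)
  have h1 : HasFDerivAt (fun z : E4 => √(‖z‖ ^ 2))
      ((1 / (2 * √(‖y‖ ^ 2))) • ((2 : ℕ) • innerSL ℝ y)) y :=
    (hasStrictFDerivAt_norm_sq y).hasFDerivAt.sqrt hy2
  have h2 : (fun z : E4 => √(‖z‖ ^ 2)) = (‖·‖) := funext fun _ => Real.sqrt_sq (norm_nonneg _)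
  rw [h2, Real.sqrt_sq (norm_nonneg y)] at h1
  convert h1 using 1
  ext v
  simp only [smul_apply, innerSL_apply_apply, smul_eq_mul, nsmul_eq_mul, Nat.cast_ofNat]
  ring

/-- **Derivative of the interpolation** `z ↦ z + a(‖z‖) • (f z - z)` at a point `y ≠ 0` where
`f` has differential `K` and `a` has derivative `a'` at `‖y‖`:
`dκ'(y) = id + a(‖y‖) (K - id) + (a' ‖y‖⁻¹ ⟪y, ·⟫) ⊗ (f y - y)`. [folklore] -/
theorem collarInterp_hasFDerivAt (f : E4 → E4) (a : ℝ → ℝ) {y : E4} (hy : y ≠ 0) {K : E4 →L[ℝ] E4}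
    {a' : ℝ} (hf : HasFDerivAt f K y) (ha : HasDerivAt a a' ‖y‖) :
    HasFDerivAt (fun z : E4 => z + a ‖z‖ • (f z - z))
      (ContinuousLinearMap.id ℝ E4 + (a ‖y‖ • (K - ContinuousLinearMap.id ℝ E4) +
        (a' • (‖y‖⁻¹ • innerSL ℝ y)).smulRight (f y - y))) y := by
  have haN : HasFDerivAt (fun z : E4 => a ‖z‖) (a' • (‖y‖⁻¹ • innerSL ℝ y)) y :=
    ha.comp_hasFDerivAt y (collarInterp_hasFDerivAt_norm hy)
  have hg : HasFDerivAt (fun z : E4 => f z - z) (K - ContinuousLinearMap.id ℝ E4) y :=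
    hf.sub (hasFDerivAt_id y)
  exact (hasFDerivAt_id y).add (haN.smul hg)

/-- **The reversed cut-off profile.** For a differentiable `χ`, the profile `a r = 1 - χ (1 - r)`
has derivative `a' r = χ' (1 - r)`. [folklore] -/
theorem collarInterp_hasDerivAt_profile (χ : ℝ → ℝ) (hχ : Differentiable ℝ χ) (r : ℝ) :
    HasDerivAt (fun s : ℝ => 1 - χ (1 - s)) (deriv χ (1 - r)) r := by
  have h1 : HasDerivAt (fun s : ℝ => χ (1 - s)) (deriv χ (1 - r) * -1) r :=
    (hχ (1 - r)).hasDerivAt.comp r ((hasDerivAt_id r).const_sub 1)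
  exact (h1.const_sub 1).congr_deriv (by ring)

/-- **Helper D2 (collar interpolation).** Given a collar map `κ` which is a smooth immersion on
the shell `|‖y‖ - 1| < δ₁`, its first-order data at the unit sphere (the conclusion of
`helper_collarFirstOrder`) and log-slow smooth steps at every scale (the conclusion of
`helper_slowStep`), there is a map `κ'`, smooth with injective differential on the open ball
`‖y‖ < 1 + δ₁`, equal to `κ` on the outer collar `1 - δ₂ < ‖y‖` and to the identity on
`‖y‖ ≤ 1 - δ₁`; moreover `1 / 2 < ‖κ y‖` on the thin shell `1 - δ₂ < ‖y‖ < 1 + δ₂`.  The map is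
`κ' y = y + a(‖y‖) • (κ y - y)` with `a r = 1 - χ (1 - r)`; injectivity of `dκ'` on the
transition zone is the Sherman–Morrison estimate `collarInterp_eq_zero_of_fderiv_eq_zero`.
[folklore] -/
theorem helper_collarInterpolation :
    ∀ (κ : E4 → E4) (δ₁ : ℝ), 0 < δ₁ → δ₁ < 1 →
      (∀ y : E4, |‖y‖ - 1| < δ₁ → ContDiffAt ℝ ∞ κ y ∧ Injective (fderiv ℝ κ y)) →
      (∃ m W : ℝ, 0 < m ∧ 0 ≤ W ∧
        (∀ θ : E4, ‖θ‖ = 1 →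
          m ≤ inner ℝ (fderiv ℝ κ θ θ) θ ∧ ‖fderiv ℝ κ θ‖ ≤ W ∧
          ∀ v : E4, inner ℝ v θ = 0 → fderiv ℝ κ θ v = v) ∧
        ∀ ε : ℝ, 0 < ε → ∃ δ : ℝ, 0 < δ ∧ δ < δ₁ ∧
          ∀ θ : E4, ‖θ‖ = 1 → ∀ r : ℝ, |r - 1| < δ →
            ‖fderiv ℝ κ (r • θ) - fderiv ℝ κ θ‖ ≤ ε ∧
            ‖κ (r • θ) - r • θ - (r - 1) • (fderiv ℝ κ θ θ - θ)‖ ≤ ε * |r - 1|) →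
      (∀ (t₁ η : ℝ), 0 < t₁ → 0 < η →
        ∃ (t₀ : ℝ) (χ : ℝ → ℝ), 0 < t₀ ∧ t₀ < t₁ ∧ ContDiff ℝ ∞ χ ∧
          (∀ t, t ≤ t₀ → χ t = 0) ∧ (∀ t, t₁ ≤ t → χ t = 1) ∧
          (∀ t, 0 ≤ χ t ∧ χ t ≤ 1) ∧ (∀ t, 0 ≤ deriv χ t) ∧ (∀ t, |t * deriv χ t| ≤ η)) →
      ∃ (κ' : E4 → E4) (δ₂ : ℝ), 0 < δ₂ ∧ δ₂ < δ₁ ∧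
        (∀ y : E4, ‖y‖ < 1 + δ₁ → ContDiffAt ℝ ∞ κ' y ∧ Injective (fderiv ℝ κ' y)) ∧
        (∀ y : E4, 1 - δ₂ < ‖y‖ → κ' y = κ y) ∧
        (∀ y : E4, ‖y‖ ≤ 1 - δ₁ → κ' y = y) ∧
        (∀ y : E4, 1 - δ₂ < ‖y‖ → ‖y‖ < 1 + δ₂ → 1 / 2 < ‖κ y‖) := by
  intro κ δ₁ hδ₁ hδ₁1 hshell HFO HSTEP
  obtain ⟨m, W, hm, hW, hsph, hunif⟩ := HFO
  -- constants
  obtain ⟨m₁, hm₁0, hm₁1, hm₁m⟩ : ∃ m₁ : ℝ, 0 < m₁ ∧ m₁ ≤ 1 ∧ m₁ ≤ m :=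
    ⟨min 1 m, lt_min one_pos hm, min_le_left _ _, min_le_right _ _⟩
  have hW1 : 0 < W + 1 := by linarith
  obtain ⟨η, hη0, hηW, hη4⟩ : ∃ η : ℝ, 0 < η ∧ η * (W + 1) ≤ m₁ / 4 ∧ η ≤ 1 / 4 := by
    refine ⟨m₁ / (4 * (W + 1)), by positivity, le_of_eq ?_, ?_⟩
    · field_simp
    · rw [div_le_div_iff₀ (by positivity) (by norm_num : (0 : ℝ) < 4)]
      nlinarith
  obtain ⟨ε, hε0, hε4, hεB⟩ : ∃ ε : ℝ, 0 < ε ∧ ε ≤ 1 / 4 ∧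
      ε * (1 + η) * (1 + 4 * (W + 1) / m₁) ≤ 1 / 2 := by
    set B := 1 + 4 * (W + 1) / m₁ with hB
    have hB1 : 1 ≤ B := le_add_of_nonneg_right (by positivity)
    refine ⟨1 / (4 * B), by positivity, one_div_le_one_div_of_le (by norm_num) (by linarith), ?_⟩
    rw [show 1 / (4 * B) * (1 + η) * B = (1 + η) / 4 by field_simp]
    linarith
  obtain ⟨δ, hδ0, hδδ₁, hδ⟩ := hunif ε hε0
  obtain ⟨t₀, χ, ht₀0, ht₀δ, hχs, hχ0, hχ1, hχ01, hχ', hχslow⟩ :=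
    HSTEP (δ / 2) η (by positivity) hη0
  -- the cut-off profile `a r = 1 - χ (1 - r)`
  obtain ⟨a, ha⟩ : ∃ a : ℝ → ℝ, a = fun r => 1 - χ (1 - r) := ⟨_, rfl⟩
  have ha1 : ∀ r, 1 - t₀ ≤ r → a r = 1 := fun r hr => by
    simp only [ha, hχ0 _ (by linarith : 1 - r ≤ t₀), sub_zero]
  have ha0 : ∀ r, r ≤ 1 - δ / 2 → a r = 0 := fun r hr => by
    simp only [ha, hχ1 _ (by linarith : δ / 2 ≤ 1 - r), sub_self]
  have ha01 : ∀ r, 0 ≤ a r ∧ a r ≤ 1 := fun r => by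
    simp only [ha]; constructor <;> linarith [hχ01 (1 - r)]
  have hχd : Differentiable ℝ χ := hχs.differentiable (by simp)
  have haD : ∀ r, HasDerivAt a (deriv χ (1 - r)) r := fun r => by
    rw [ha]; exact collarInterp_hasDerivAt_profile χ hχd r
  have has : ContDiff ℝ ∞ a := by
    rw [ha]; exact contDiff_const.sub (hχs.comp (contDiff_const.sub contDiff_id))
  -- the interpolation
  obtain ⟨κ', hκ'⟩ : ∃ κ' : E4 → E4, κ' = fun y => y + a ‖y‖ • (κ y - y) := ⟨_, rfl⟩
  have hδ₂W : 0 < 1 / (4 * (W + 3)) := by positivity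
  refine ⟨κ', min t₀ (1 / (4 * (W + 3))), lt_min ht₀0 hδ₂W,
    (min_le_left _ _).trans_lt (by linarith), ?_, ?_, ?_, ?_⟩
  · -- smooth immersion on the ball `‖y‖ < 1 + δ₁`
    intro y hy
    by_cases h2 : ‖y‖ < 1 - δ / 2
    · -- inner region: `κ' = id` near `y`
      have hev : κ' =ᶠ[𝓝 y] id := by
        filter_upwards [(isOpen_lt continuous_norm continuous_const).mem_nhds h2] with z hz
        simp only [hκ', ha0 _ (le_of_lt hz), zero_smul, add_zero, id]
      refine ⟨contDiffAt_id.congr_of_eventuallyEq hev, ?_⟩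
      rw [hev.fderiv_eq, fderiv_id]
      exact fun u u' h => by simpa using h
    have h2' : 1 - δ / 2 ≤ ‖y‖ := not_lt.mp h2
    have hr0 : 0 < ‖y‖ := by linarith
    have hy0 : y ≠ 0 := norm_pos_iff.mp hr0
    have hyU : |‖y‖ - 1| < δ₁ := by rw [abs_lt]; constructor <;> linarith
    by_cases h3 : 1 - t₀ < ‖y‖
    · -- outer region: `κ' = κ` near `y`
      have hev : κ' =ᶠ[𝓝 y] κ := by
        filter_upwards [(isOpen_lt continuous_const continuous_norm).mem_nhds h3] with z hz
        simp only [hκ', ha1 _ (le_of_lt hz), one_smul, add_sub_cancel]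
      refine ⟨(hshell y hyU).1.congr_of_eventuallyEq hev, ?_⟩
      rw [hev.fderiv_eq]; exact (hshell y hyU).2
    -- transition zone `1 - δ/2 ≤ ‖y‖ ≤ 1 - t₀`
    have h3' : ‖y‖ ≤ 1 - t₀ := not_lt.mp h3
    have hK : HasFDerivAt κ (fderiv ℝ κ y) y :=
      ((hshell y hyU).1.differentiableAt (by simp)).hasFDerivAt
    have hD := collarInterp_hasFDerivAt κ a hy0 hK (haD ‖y‖)
    refine ⟨?_, ?_⟩
    · rw [hκ']
      exact contDiffAt_id.add ((has.contDiffAt.comp y (contDiffAt_norm ℝ hy0)).smul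
        ((hshell y hyU).1.sub contDiffAt_id))
    rw [hκ', hD.fderiv]
    refine (injective_iff_map_eq_zero _).2 fun v hv => ?_
    -- polar data at `y`
    set r : ℝ := ‖y‖ with hr
    set θ : E4 := r⁻¹ • y with hθ_def
    have hθ : ‖θ‖ = 1 := by
      rw [hθ_def, norm_smul, norm_inv, Real.norm_eq_abs, abs_of_pos hr0, inv_mul_cancel₀ hr0.ne']
    have hyr : r • θ = y := by rw [hθ_def, smul_smul, mul_inv_cancel₀ hr0.ne', one_smul]
    have hr1 : |r - 1| < δ := by rw [abs_lt]; constructor <;> linarith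
    obtain ⟨hE₁, hE₂⟩ := hδ θ hθ r hr1
    rw [hyr] at hE₁ hE₂
    obtain ⟨hmG, hKW, htang⟩ := hsph θ hθ
    have hK₀v := collarInterp_apply_eq_of_tangential θ hθ (fderiv ℝ κ θ) htang
    have hθθ : inner ℝ θ θ = 1 := by rw [real_inner_self_eq_norm_sq, hθ, one_pow]
    have hKθ : ‖fderiv ℝ κ θ θ‖ ≤ W :=
      (ContinuousLinearMap.le_opNorm _ _).trans (by rw [hθ, mul_one]; exact hKW)
    have hGeq : 1 + inner ℝ θ (fderiv ℝ κ θ θ - θ) = inner ℝ (fderiv ℝ κ θ θ) θ := by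
      rw [inner_sub_right, hθθ, real_inner_comm]; ring
    have hG₁ : m₁ ≤ 1 + inner ℝ θ (fderiv ℝ κ θ θ - θ) := by rw [hGeq]; exact hm₁m.trans hmG
    have hG₂ : 1 + inner ℝ θ (fderiv ℝ κ θ θ - θ) ≤ W := by
      rw [hGeq]
      exact (real_inner_le_norm _ _).trans (by rw [hθ, mul_one]; exact hKθ)
    have hw : ‖fderiv ℝ κ θ θ - θ‖ ≤ W + 1 := (norm_sub_le _ _).trans (by rw [hθ]; gcongr)
    have hq0 : 0 ≤ (1 - r) * deriv χ (1 - r) := mul_nonneg (by linarith) (hχ' _)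
    have hqη : (1 - r) * deriv χ (1 - r) ≤ η := (le_abs_self _).trans (hχslow (1 - r))
    have hv' : v + a r • (fderiv ℝ κ y v - v) +
        (deriv χ (1 - r) * inner ℝ θ v) • (κ y - y) = 0 := by
      have hθv : inner ℝ θ v = r⁻¹ * inner ℝ y v := by rw [hθ_def, real_inner_smul_left]
      rw [hθv]
      simpa only [add_apply, smul_apply, sub_apply, ContinuousLinearMap.id_apply,
        ContinuousLinearMap.smulRight_apply, innerSL_apply_apply, smul_eq_mul, add_assoc]
        using hv
    exact collarInterp_eq_zero_of_fderiv_eq_zero hθ hK₀v hG₁ hG₂ hw hE₁ hE₂ (ha01 r).1 (ha01 r).2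
      hq0 hqη hm₁0 hm₁1 hW hηW hε0.le hεB hv'
  · -- `κ' = κ` on the outer collar
    intro y hy
    have h : 1 - t₀ ≤ ‖y‖ := by linarith [min_le_left t₀ (1 / (4 * (W + 3)))]
    simp only [hκ', ha1 _ h, one_smul, add_sub_cancel]
  · -- `κ' = id` on the inner ball
    intro y hy
    have h : ‖y‖ ≤ 1 - δ / 2 := by linarith
    simp only [hκ', ha0 _ h, zero_smul, add_zero]
  · -- `1 / 2 < ‖κ y‖` on the thin shell
    intro y hlo hhi
    have hδ₂t : min t₀ (1 / (4 * (W + 3))) ≤ t₀ := min_le_left _ _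
    have hδ₂W' : min t₀ (1 / (4 * (W + 3))) ≤ 1 / (4 * (W + 3)) := min_le_right _ _
    have hc : 1 / (4 * (W + 3)) * (W + 3) = 1 / 4 := by field_simp
    have hW3 : 1 / (4 * (W + 3)) ≤ 1 / 12 := by nlinarith
    have hr0 : 0 < ‖y‖ := by linarith
    set r : ℝ := ‖y‖ with hr
    set θ : E4 := r⁻¹ • y with hθ_def
    have hθ : ‖θ‖ = 1 := by
      rw [hθ_def, norm_smul, norm_inv, Real.norm_eq_abs, abs_of_pos hr0, inv_mul_cancel₀ hr0.ne']
    have hyr : r • θ = y := by rw [hθ_def, smul_smul, mul_inv_cancel₀ hr0.ne', one_smul]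
    have hD : |r - 1| < 1 / (4 * (W + 3)) := by rw [abs_lt]; constructor <;> linarith
    obtain ⟨-, hE₂⟩ := hδ θ hθ r (by rw [abs_lt]; constructor <;> linarith)
    rw [hyr] at hE₂
    obtain ⟨-, hKW, -⟩ := hsph θ hθ
    have hKθ : ‖fderiv ℝ κ θ θ‖ ≤ W :=
      (ContinuousLinearMap.le_opNorm _ _).trans (by rw [hθ, mul_one]; exact hKW)
    have hw : ‖fderiv ℝ κ θ θ - θ‖ ≤ W + 1 := (norm_sub_le _ _).trans (by rw [hθ]; gcongr)
    have h1 : ‖κ y - y‖ ≤ ε * |r - 1| + |r - 1| * (W + 1) := by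
      calc ‖κ y - y‖ = ‖(κ y - y - (r - 1) • (fderiv ℝ κ θ θ - θ)) +
            (r - 1) • (fderiv ℝ κ θ θ - θ)‖ := by rw [sub_add_cancel]
        _ ≤ ‖κ y - y - (r - 1) • (fderiv ℝ κ θ θ - θ)‖ +
            ‖(r - 1) • (fderiv ℝ κ θ θ - θ)‖ := norm_add_le _ _
        _ ≤ ε * |r - 1| + |r - 1| * (W + 1) := by
            rw [norm_smul, Real.norm_eq_abs]; gcongr
    have h2 : ‖y‖ - ‖κ y‖ ≤ ‖κ y - y‖ := by rw [norm_sub_rev]; exact norm_sub_norm_le _ _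
    nlinarith [mul_lt_mul_of_pos_right hD (by linarith : (0 : ℝ) < W + 3),
      mul_le_mul_of_nonneg_right hε4 (abs_nonneg (r - 1)), abs_nonneg (r - 1)]
end Summit.SmoothPoincare4.SmoothPoincare4.Theorems.Target.KaehlerJacket

end
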